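import Summits.Ventures.CertifiedManyBodySolver.Theorems.M3x2EdgeSplitSymReplaySound
import HarnessLib

/-!
# SymReplay — S4 in EXPANSION FORM: the soundness head for SHARDED (multi-call) certificate replays (T12a; hub-lb-sym-eng-3)
`wardD4CertGe_of_expansion`: a well-formed `SymCert` whose window identity holds in the envelope algebra up to ANY supplied list
of per-word licensed identification uses is a `WardD4CertGe (symValue K)` certificate.  The landed monolithic soundness
(`stub_soundOfKernels`, T10) is the special case `U := canonUses K`; the sharded checker (T12b) supplies `U` per farm call.
No summit or crux statement is proved here; no certificate beyond toys is replayed; nothing here predicts superconductivity.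
-/

noncomputable section

namespace Summit.Ventures.CertifiedManyBodySolver.Theorems.SymReplay

open Matrix Finset
open Literature.MathematicalPhysics.QuantumLattice
open Literature.MathematicalPhysics.QuantumLattice.HubbardWave0
open Literature.MathematicalPhysics.QuantumLattice.ThermodynamicLimit
open Literature.Probability.LatticeModels
open Literature.MathematicalPhysics.QuantumManyBody.StateRelaxation
open Summit.Ventures.CertifiedManyBodySolver.Theorems.WardSlot
open scoped ComplexOrder BigOperators

/-! #### S4 in expansion form — the soundness head for SHARDED (multi-call) replays (hub-lb-sym-eng-3 g1) -/

/-- The identification uses of the explicit `moves` hints. -/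
def movesUses (K : SymCert) : List IdUse := K.moves.map fun mv => (⟨mv.z, mv.u, mv.γ, mv.v⟩ : IdUse)

/-- All uses: the explicit hints, then a supplied list `U`. -/
def usesList (K : SymCert) (U : List IdUse) : List IdUse := movesUses K ++ U

/-- **The envelope `Λ'⁺(K, U)`**: the king-move thickening of the frame together with every affine-`D₄` image of the
frame under a used move (explicit hints and `U`). -/
def envelope (K : SymCert) (U : List IdUse) : Finset (Site 2) :=
  thicken K.frame.toFinset 1 ∪ (usesList K U).foldr (fun e S => d4ShiftSet e.γ e.v K.frame.toFinset ∪ S) ∅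

/-- Every used move is licensed for `Λ := frame` inside the envelope. -/
theorem d4ShiftSet_subset_envelope (K : SymCert) (U : List IdUse) {e : IdUse} (he : e ∈ usesList K U) :
    d4ShiftSet e.γ e.v K.frame.toFinset ⊆ envelope K U :=
  (subset_foldr_d4ShiftSet _ _ e he).trans Finset.subset_union_right

/-- The envelope contains the thickened frame. -/
theorem thicken_subset_envelope (K : SymCert) (U : List IdUse) : thicken K.frame.toFinset 1 ⊆ envelope K U :=
  Finset.subset_union_left

/-- Words of all uses lie in the frame. -/
theorem usesList_supp (K : SymCert) (U : List IdUse)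
    (hmov : ∀ mv ∈ K.moves, suppIn mv.u K.frame = true ∧ suppIn (moveWordF mv.γ mv.v mv.u) K.frame = true)
    (hU : ∀ e ∈ U, SuppIn e.u K.frame.toFinset) : ∀ e ∈ usesList K U, SuppIn e.u K.frame.toFinset := by
  intro e he
  rw [usesList, List.mem_append] at he
  rcases he with he | he
  · rw [movesUses, List.mem_map] at he
    obtain ⟨mv, hmv, rfl⟩ := he
    exact SuppIn_of_suppIn (hmov mv hmv).1
  · exact hU e he

/-- **S4 in EXPANSION FORM (for multi-call / sharded replays).** If `K` is well formed and, in the window algebra of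
the envelope `Λ'⁺ := envelope K U`, the operator identity `LHS = RHS + Σ_{e ∈ U} z_e • (wordOp (γ_e u_e + v_e) − wordOp u_e)`
holds for SOME list `U` of per-word licensed identification uses (`u_e` supported in the frame), then `K` is a
Ward × affine-`D₄` window certificate of value `symValue K`.  The landed `stub_soundOfKernels` is the case
`U := canonUses K` read off the monolithic `identityOK`; a sharded replay supplies `U` shard by shard. -/
theorem wardD4CertGe_of_expansion (K : SymCert) (hwf0 : wellFormed K = true) (U : List IdUse)
    (hU : ∀ e ∈ U, SuppIn e.u K.frame.toFinset)
    (hexp : polyOp (envelope K U).toList.toFinset (lhsPoly K) =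
      polyOp (envelope K U).toList.toFinset (rhsPoly K) +
        (U.map (useOp (envelope K U).toList.toFinset)).sum) :
    WardD4CertGe ((symValue K : ℚ) : ℝ) := by
  have h1 : NfFaithful := stub_nfFaithful
  have h3 : DictionarySound := stub_dictionarySound
  /- (0) unpack well-formedness -/
  have hwf := hwf0
  simp only [wellFormed, Bool.and_eq_true] at hwf
  obtain ⟨⟨⟨⟨⟨⟨⟨⟨⟨⟨⟨⟨⟨hnd, hz0⟩, hn0⟩, hIF⟩, hth⟩, hgram⟩, hgM⟩, heom⟩, hmov⟩, hch⟩, hwp⟩, hwm⟩, hah⟩, hsl⟩ := hwf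
  have hgram' : ∀ g ∈ K.gram, 0 ≤ g.1 ∧ psuppIn g.2 K.frame = true := fun g hg => by
    have h := List.all_eq_true.1 hgram g hg
    rw [Bool.and_eq_true, decide_eq_true_eq] at h
    exact h
  have hgM' : ∀ B ∈ K.gramM, 0 ≤ B.scale ∧ (∀ r ∈ B.rows, rowAsc r = true) ∧
      (∀ q ∈ B.basis, psuppIn q K.frame = true) := fun B hB => by
    have h := List.all_eq_true.1 hgM B hB
    simp only [gramBlockOK, Bool.and_eq_true, decide_eq_true_eq, List.all_eq_true] at h
    exact ⟨h.1.1.1, h.1.2, h.2⟩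
  have heom' : ∀ B ∈ K.eom, psuppIn B K.inner = true := fun B hB => List.all_eq_true.1 heom B hB
  have hmov' : ∀ mv ∈ K.moves, suppIn mv.u K.frame = true ∧ suppIn (moveWordF mv.γ mv.v mv.u) K.frame = true :=
    fun mv hmv => by
      have h := List.all_eq_true.1 hmov mv hmv
      rwa [Bool.and_eq_true] at h
  have hch' : ∀ t ∈ K.charged, suppIn t.2 K.frame = true ∧ (wordCharge t.2 ≠ 0 ∨ wordSpinCharge t.2 ≠ 0) :=
    fun t ht => by
      have h := List.all_eq_true.1 hch t ht
      rw [Bool.and_eq_true, Bool.or_eq_true] at h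
      exact ⟨h.1, h.2.imp bne_iff_ne.1 bne_iff_ne.1⟩
  have hwp' : ∀ X ∈ K.wardP, psuppIn X K.frame = true := fun X hX => List.all_eq_true.1 hwp X hX
  have hwm' : ∀ X ∈ K.wardM, psuppIn X K.frame = true := fun X hX => List.all_eq_true.1 hwm X hX
  have hah' : ∀ t ∈ K.antiH, psuppIn t.2 K.frame = true := fun t ht => List.all_eq_true.1 hah t ht
  have hsl' : ∀ t ∈ K.slack, suppIn t.2 K.frame = true := fun t ht => List.all_eq_true.1 hsl t ht
  /- (1) the frame `F`, the inner window `I ⊆ F`, the enlarged frame `Λ'⁺ = (envelope K U).toList.toFinset` -/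
  have hIF' : K.inner.toFinset ⊆ K.frame.toFinset := fun x hx =>
    List.mem_toFinset.2 ((subSites_iff _ _).1 hIF x (List.mem_toFinset.1 hx))
  have hthF : thicken K.inner.toFinset 1 ⊆ K.frame.toFinset := thicken_subset_of_thick hth
  have h0F : thicken ({0} : Finset (Site 2)) 1 ⊆ K.frame.toFinset := by
    have h : subSites (thick [0]) K.frame = true := by simpa [thick] using hn0
    have h' := thicken_subset_of_thick h
    simpa using h'
  have hzF : (0 : Site 2) ∈ K.frame.toFinset := List.mem_toFinset.2 ((memSite_iff _ _).1 hz0)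
  have hL : (envelope K U).toList.toFinset = envelope K U := Finset.toList_toFinset _
  have hFL : K.frame.toFinset ⊆ (envelope K U).toList.toFinset := by
    rw [hL]; exact (subset_thicken _ 1).trans (thicken_subset_envelope K U)
  have h8 : thicken K.frame.toFinset 1 ⊆ (envelope K U).toList.toFinset := by
    rw [hL]; exact thicken_subset_envelope K U
  have h0 : thicken ({0} : Finset (Site 2)) 1 ⊆ (envelope K U).toList.toFinset := h0F.trans hFL
  have hz : (0 : Site 2) ∈ (envelope K U).toList.toFinset := hFL hzF
  have hfr : ∀ x ∈ K.frame, x ∈ (envelope K U).toList.toFinset := fun x hx => hFL (List.mem_toFinset.2 hx)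
  have hndL : nodupSites (envelope K U).toList = true := nodupSites_of_nodup _ (Finset.nodup_toList _)
  have hshf : ∀ l : Fin (usesList K U).length,
      d4ShiftSet ((usesList K U).get l).γ ((usesList K U).get l).v K.frame.toFinset ⊆ (envelope K U).toList.toFinset :=
    fun l => by rw [hL]; exact d4ShiftSet_subset_envelope K U (List.get_mem _ l)
  /- (2) the dictionary (S3) in `F` and in `Λ'⁺`; supports; the residual equation -/
  obtain ⟨hHF, -, -, hSpF, hSmF⟩ := h3 K.frame hnd
  obtain ⟨-, hEL, hDL, -, -⟩ := h3 (envelope K U).toList hndL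
  have htt : ∀ e ∈ usesList K U, SuppIn e.u K.frame.toFinset := usesList_supp K U hmov' hU
  /- (3) the witness -/
  refine ⟨K.frame.toFinset, (envelope K U).toList.toFinset, hFL, h8, h0, hz, (K.mu : ℝ),
    Fintype.card (GramIdx K), (gramMat K).submatrix (Fintype.equivFin (GramIdx K)).symm (Fintype.equivFin (GramIdx K)).symm,
    ?_, gramGen K (envelope K U).toList.toFinset ∘ (Fintype.equivFin (GramIdx K)).symm,
    K.eom.length, fun k => polyOp K.frame.toFinset (K.eom.get k),
    (usesList K U).length, fun l => ((usesList K U).get l).γ, fun l => ((usesList K U).get l).v, hshf,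
    fun l => ((((usesList K U).get l).z : ℚ) : ℂ) • wordOp K.frame.toFinset ((usesList K U).get l).u,
    K.charged.length, fun j => (((K.charged.get j).1 : ℚ) : ℂ),
    fun j => orbWord (envelope K U).toList.toFinset hz (K.charged.get j).2, ?_,
    K.wardP.length, fun r => polyOp (envelope K U).toList.toFinset (K.wardP.get r),
    K.wardM.length, fun r => polyOp (envelope K U).toList.toFinset (K.wardM.get r),
    K.antiH.length, fun m => (((K.antiH.get m).1 : ℚ) : ℝ),
    fun m => polyOp (envelope K U).toList.toFinset (K.antiH.get m).2,
    K.slack.length, fun k => (((K.slack.get k).1 : ℚ) : ℂ),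
    fun k => orbWord (envelope K U).toList.toFinset hz (K.slack.get k).2,
    (K.c : ℝ), ?_, ?_⟩
  · /- the Gram multiplier is PSD (diagonal SOS weights ⊕ `scale • L Lᴴ` blocks, re-indexed) -/
    exact (gramMat_posSemidef K (fun g hg => (hgram' g hg).1) (fun B hB => (hgM' B hB).1)).submatrix _
  · /- charged words carry a charge -/
    intro j _
    rw [ladderCharge_orbWord, ladderSpinCharge_orbWord]
    exact (hch' _ (List.get_mem _ j)).2
  · /- THE IDENTITY in `𝔄_{Λ'⁺}` -/
    unfold WardD4Identity
    dsimp only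
    -- left-hand side
    have hLHS : polyOp (envelope K U).toList.toFinset (lhsPoly K) =
        fermionEmbed (PolySite.incl h0) ((hubbardTTPrimeFermionInteraction 1 0 8).meanEnergyObs 1) -
          ((K.c : ℝ) : ℂ) • (1 : FermionOp (envelope K U).toList.toFinset) -
          (((K.mu : ℝ) : ℝ) : ℂ) • (nAt 0 hz 0 + nAt 0 hz 1 -
            (((7 / 8 : ℝ) : ℝ) : ℂ) • (1 : FermionOp (envelope K U).toList.toFinset)) := by
      rw [lhsPoly, polyOp_append, polyOp_append, polyOp_pscale, polyOp_append, polyOp_append, hEL h0, hDL hz 0,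
        hDL hz 1, polyOp_single, polyOp_single, wordOp_nil]
      push_cast
      module
    -- Gram part (SOS factors + matrix blocks, one re-indexed Gram form)
    have hG : gramForm ((gramMat K).submatrix (Fintype.equivFin (GramIdx K)).symm (Fintype.equivFin (GramIdx K)).symm)
          (gramGen K (envelope K U).toList.toFinset ∘ (Fintype.equivFin (GramIdx K)).symm) =
        polyOp (envelope K U).toList.toFinset (K.gram.flatMap fun g => pscale g.1 (pmul (padj g.2) g.2)) +
          polyOp (envelope K U).toList.toFinset (K.gramM.flatMap gramBlockPoly) := by
      rw [gramForm_reindex, gramForm_gramMat K _ (fun B hB => (hgM' B hB).2.1)]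
    -- EOM part
    have hE : polyOp (envelope K U).toList.toFinset (K.eom.flatMap fun B => comm (hamPoly K.frame) B) =
        ∑ k : Fin K.eom.length,
          ((hubbardTTPrimeFermionInteraction 1 0 8).localHamiltonian (envelope K U).toList.toFinset *
              fermionEmbed (PolySite.incl hFL) (polyOp K.frame.toFinset (K.eom.get k)) -
            fermionEmbed (PolySite.incl hFL) (polyOp K.frame.toFinset (K.eom.get k)) *
              (hubbardTTPrimeFermionInteraction 1 0 8).localHamiltonian (envelope K U).toList.toFinset) := by
      rw [polyOp_flatMap, ← sum_fin_get]
      refine Finset.sum_congr rfl fun k _ => ?_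
      have hB : PSupp (K.eom.get k) K.inner.toFinset := PSupp_of_psuppIn (heom' _ (List.get_mem _ k))
      rw [polyOp_comm, polyOp_incl hFL (hamPoly K.frame) (PSupp_hamPoly K.frame), hHF, polyOp_incl hFL _ (hB.mono hIF'),
        polyOp_incl hIF' _ hB, ← map_mul, ← map_mul, ← map_sub, ← ham_commutator_transfer hIF' hthF hFL]
    -- explicit moves
    have hMv : polyOp (envelope K U).toList.toFinset
          (K.moves.flatMap fun mv => [(mv.z, moveWord mv.γ mv.v mv.u), (-mv.z, mv.u)]) =
        ((K.moves.map fun mv => (⟨mv.z, mv.u, mv.γ, mv.v⟩ : IdUse)).map (useOp (envelope K U).toList.toFinset)).sum := by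
      rw [polyOp_flatMap, List.map_map]
      congr 1
      refine List.map_congr_left fun mv _ => ?_
      simp only [Function.comp, useOp, polyOp_cons, polyOp_nil, add_zero]
      push_cast
      module
    -- the identification family
    have hT : ∑ l : Fin (usesList K U).length,
        (fermionEmbed (PolySite.incl (hshf l))
            (fermionEmbed (PolySite.d4Emb ((usesList K U).get l).γ ((usesList K U).get l).v K.frame.toFinset)
              (((((usesList K U).get l).z : ℚ) : ℂ) • wordOp K.frame.toFinset ((usesList K U).get l).u)) -
          fermionEmbed (PolySite.incl hFL)
            (((((usesList K U).get l).z : ℚ) : ℂ) • wordOp K.frame.toFinset ((usesList K U).get l).u)) =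
        ((usesList K U).map (useOp (envelope K U).toList.toFinset)).sum := by
      rw [← sum_fin_get]
      refine Finset.sum_congr rfl fun l _ => ?_
      have hu : SuppIn ((usesList K U).get l).u K.frame.toFinset := htt _ (List.get_mem _ l)
      rw [map_smul, map_smul, map_smul, ← wordOp_moveWord (hshf l) _ hu, ← wordOp_incl hFL _ hu, useOp, smul_sub]
    -- charged words
    have hC : polyOp (envelope K U).toList.toFinset K.charged =
        ∑ j : Fin K.charged.length, (((K.charged.get j).1 : ℚ) : ℂ) •
          ladderWord (orbWord (envelope K U).toList.toFinset hz (K.charged.get j).2) := by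
      rw [polyOp, ← sum_fin_get]
      refine Finset.sum_congr rfl fun j _ => ?_
      rw [ladderWord_orbWord _ _ _ ((SuppIn_of_suppIn (hch' _ (List.get_mem _ j)).1).mono hFL)]
    -- Ward families
    have hP : polyOp (envelope K U).toList.toFinset (K.wardP.flatMap fun X => comm (spinPlusPoly K.frame) X) =
        ∑ r : Fin K.wardP.length,
          ((spinPlus : FermionOp (envelope K U).toList.toFinset) * polyOp (envelope K U).toList.toFinset (K.wardP.get r) -
            polyOp (envelope K U).toList.toFinset (K.wardP.get r) * spinPlus) := by
      rw [polyOp_flatMap, ← sum_fin_get]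
      refine Finset.sum_congr rfl fun r _ => ?_
      have hX : PSupp (K.wardP.get r) K.frame.toFinset := PSupp_of_psuppIn (hwp' _ (List.get_mem _ r))
      rw [polyOp_comm, polyOp_incl hFL (spinPlusPoly K.frame) (PSupp_spinPlusPoly K.frame), hSpF, polyOp_incl hFL _ hX,
        ← map_mul, ← map_mul, ← map_sub, ← spinPlus_commutator_transfer hFL]
    have hPm : polyOp (envelope K U).toList.toFinset (K.wardM.flatMap fun X => comm (spinMinusPoly K.frame) X) =
        ∑ r : Fin K.wardM.length,
          ((spinMinus : FermionOp (envelope K U).toList.toFinset) * polyOp (envelope K U).toList.toFinset (K.wardM.get r) -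
            polyOp (envelope K U).toList.toFinset (K.wardM.get r) * spinMinus) := by
      rw [polyOp_flatMap, ← sum_fin_get]
      refine Finset.sum_congr rfl fun r _ => ?_
      have hX : PSupp (K.wardM.get r) K.frame.toFinset := PSupp_of_psuppIn (hwm' _ (List.get_mem _ r))
      rw [polyOp_comm, polyOp_incl hFL (spinMinusPoly K.frame) (PSupp_spinMinusPoly K.frame), hSmF,
        polyOp_incl hFL _ hX, ← map_mul, ← map_mul, ← map_sub, ← spinMinus_commutator_transfer hFL]
    -- anti-Hermitian parts
    have hA : polyOp (envelope K U).toList.toFinset (K.antiH.flatMap fun t => pscale t.1 (psub (padj t.2) t.2)) =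
        ∑ m : Fin K.antiH.length, ((((K.antiH.get m).1 : ℚ) : ℝ) : ℂ) •
          ((polyOp (envelope K U).toList.toFinset (K.antiH.get m).2)ᴴ -
            polyOp (envelope K U).toList.toFinset (K.antiH.get m).2) := by
      rw [polyOp_flatMap, ← sum_fin_get]
      refine Finset.sum_congr rfl fun m _ => ?_
      rw [polyOp_pscale, polyOp_psub, polyOp_padj, Complex.ofReal_ratCast]
    -- slack words
    have hS : polyOp (envelope K U).toList.toFinset K.slack =
        ∑ k : Fin K.slack.length, (((K.slack.get k).1 : ℚ) : ℂ) •
          ladderWord (orbWord (envelope K U).toList.toFinset hz (K.slack.get k).2) := by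
      rw [polyOp, ← sum_fin_get]
      refine Finset.sum_congr rfl fun k _ => ?_
      rw [ladderWord_orbWord _ _ _ ((SuppIn_of_suppIn (hsl' _ (List.get_mem _ k))).mono hFL)]
    -- the right-hand side, family by family
    have hRHS : polyOp (envelope K U).toList.toFinset (rhsPoly K) =
        polyOp (envelope K U).toList.toFinset (K.gram.flatMap fun g => pscale g.1 (pmul (padj g.2) g.2)) +
        polyOp (envelope K U).toList.toFinset (K.gramM.flatMap gramBlockPoly) +
        polyOp (envelope K U).toList.toFinset (K.eom.flatMap fun B => comm (hamPoly K.frame) B) +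
        polyOp (envelope K U).toList.toFinset
          (K.moves.flatMap fun mv => [(mv.z, moveWord mv.γ mv.v mv.u), (-mv.z, mv.u)]) +
        polyOp (envelope K U).toList.toFinset K.charged +
        polyOp (envelope K U).toList.toFinset (K.wardP.flatMap fun X => comm (spinPlusPoly K.frame) X) +
        polyOp (envelope K U).toList.toFinset (K.wardM.flatMap fun X => comm (spinMinusPoly K.frame) X) +
        polyOp (envelope K U).toList.toFinset (K.antiH.flatMap fun t => pscale t.1 (psub (padj t.2) t.2)) +
        polyOp (envelope K U).toList.toFinset K.slack := by
      simp only [rhsPoly, polyOp_append]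
    -- assemble
    conv at hT => rhs; rw [usesList, List.map_append, List.sum_append]
    have hCn := eq_sub_of_add_eq' hT.symm
    rw [← hLHS, hexp, hRHS, hG, hE, hMv, hC, hP, hPm, hA, hS, hCn, movesUses]
    abel
  · /- the value -/
    dsimp only
    simp only [norm_ratCast_complex]
    rw [← Rat.cast_sum, sum_fin_get K.slack (fun t => |t.1|)]
    have hv : symValue K = K.c - (K.slack.map fun t => |t.1|).sum := by
      simp only [symValue, qabs_eq_abs]
    rw [hv]
    push_cast
    exact le_rfl

end Summit.Ventures.CertifiedManyBodySolver.Theorems.SymReplay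

end
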